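import Mathlib.Topology.Algebra.ClopenNhdofOne
import Literature.AnabelianGeometry.SemiGraphs.CosetCategoriesSlim
import Literature.AlgebraicGeometry.Frobenioids.QuasiTemperoidGaloisFields
import Literature.AlgebraicGeometry.Frobenioids.PadicFrobenioidThm12Slim
import Literature.AlgebraicGeometry.Frobenioids.PadicFrobenioidMonoidData
import Literature.AnabelianGeometry.AbsoluteAnabelian.SubpadicSlimProofs
import Literature.AnabelianGeometry.AbsoluteAnabelian.SubpadicExamples
import HarnessLib

/-!
# Frobenioids II, Example 1.1 (i) / Theorem 1.2 (iv) at THE base: `D₀ = 𝓑(G_{ℚ_p})⁰` IS a slim category, hence every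
# `p`-adic Frobenioid over `D₀` is slim

Mochizuki, *The geometry of Frobenioids II*, Kyushu J. Math. **62** (2008) 401–460, §1. Example 1.1 (i), author's
text p. 7 [cite: MochizukiFrdII2008, Ex 1.1 (i) p.7]: "`C₀` … over a slim base category `D₀` [cf. [AbsAnab],
Theorem 1.1.1, (ii); [FrdI], Theorem 6.2, (iv); [FrdI], Theorem 6.4, (i)]", `D₀` being "the full subcategory of
connected objects of the Galois category of finite étale coverings of `Spec(ℚ_p)`"; Theorem 1.2 (iv) p. 9
[cite: MochizukiFrdII2008, Thm 1.2 (iv) p.9]: "If `D` is slim, and `Λ ∈ {ℤ, ℝ}`, then `C` is also slim."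

PROOF-ONLY file (no definitions). It composes three landed theorems into the printed, hypothesis-free claims at the
base `D₀`, realised (abc-iut-L1-t4, `PadicFrobenioidCZeroGalois.lean`) as the SMALL coset category
`CosetCat G_{ℚ_p}` of `G_{ℚ_p} = Gal(ℚ̄_p/ℚ_p)` (`QuasiTemperoid.GalFbar ℚ_[p]`; abc-iut-L5-t2's `CosetCategories.lean`,
equivalent to `ConnectedPart (BTemp G_{ℚ_p})`):
* [AbsAnab] Thm. 1.1.1 (ii) "`G_K` is slim" — abc-iut-L4's PROVED `IsSubpadicFor.isSlimGroup_absoluteGaloisGroup`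
  at `ℚ_p` (`AbsTopIII.IsSubpadicFor.padic`);
* "`G` slim ⇒ `𝓑(G)⁰` slim" ([FrdI] §0 pp. 13–15) — abc-iut-L1-t4 gen 3's `CosetCat.isSlim_of_isSlimGroup`
  (`CosetCategoriesSlim.lean`), whose point-separation hypothesis is discharged here for every PROFINITE group
  (`exists_openSubgroup_not_mem`, open normal subgroups are a neighbourhood basis of `1`), giving
  `isSlim_cosetCat_of_isSlimGroup` — usable verbatim for the bases `𝓑(G_v)⁰ = CosetCat G_v` of [IUTchI] Ex. 3.2–3.3;
* [FrdII] Thm. 1.2 (iv) — abc-iut-L1-d8's `Datum.thm12_iv_of_isMonoidData`, its monoid-data input automatic over a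
  base of FSM-type (abc-iut-L1-d10's `isMonoidData_of_isOfFSMType`, abc-iut-L1-t4's `CosetCat.isOfFSMType`).
Results: `isSlim_cosetCat_galQp : IsSlim (CosetCat G_{ℚ_p})` ("a slim base category `D₀`", UNCONDITIONAL) and
`Datum.isSlim_frobenioid_over_galQp : ∀ d : Datum (CosetCat G_{ℚ_p}) p, IsSlim d.frobenioid` — EVERY `p`-adic
Frobenioid (with `Λ = ℤ`, the tree's `Datum`) over THE base `D₀` is slim, in particular `C₀`; more generally over
`CosetCat G` for any slim profinite `G` (`Datum.isSlim_frobenioid_of_isSlimGroup`). Classical; nothing of the disputed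
series is asserted; no statement of the paper is strengthened.
-/

namespace Literature.AlgebraicGeometry.Frobenioids

namespace PadicFrd

open CategoryTheory Literature.AnabelianGeometry.SemiGraphs
open Literature.AnabelianGeometry.AbsoluteAnabelian

universe u

section Profinite

variable {G : Type u} [Group G] [TopologicalSpace G] [IsTopologicalGroup G] [CompactSpace G]
  [TotallyDisconnectedSpace G]

/-- In a profinite group the open subgroups separate points from `1`: for `x ≠ 1` some open (normal) subgroup
misses `x` (open normal subgroups form a neighbourhood basis of `1`, points are closed). This is the hypothesis
`hsep` of `CosetCat.isSlim_of_isSlimGroup`. [cite: MochizukiFrdI2008, §0 p.13] -/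
theorem exists_openSubgroup_not_mem (x : G) (hx : x ≠ 1) : ∃ W : OpenSubgroup G, x ∉ (W : Set G) := by
  have hopen : IsOpen ({x}ᶜ : Set G) := by
    rw [← connectedComponent_eq_singleton x]
    exact isClosed_connectedComponent.isOpen_compl
  obtain ⟨N, hN⟩ := ProfiniteGrp.exist_openNormalSubgroup_sub_open_nhds_of_one hopen
    (Set.mem_compl_singleton_iff.mpr (Ne.symm hx))
  exact ⟨N.toOpenSubgroup, fun h => (Set.mem_compl_singleton_iff.mp (hN h)) rfl⟩

/-- **"`Π` slim ⇒ `𝓑(Π)⁰` slim" for every PROFINITE `Π`** ([FrdI] §0 pp. 13–15), on the small coset model: the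
point-separation input of abc-iut-L1-t4 gen 3's `CosetCat.isSlim_of_isSlimGroup` discharged. Serves the bases
`CosetCat G_v` of [IUTchI] Ex. 3.2–3.3 as well. [cite: MochizukiFrdI2008, §0 p.13] -/
theorem isSlim_cosetCat_of_isSlimGroup (hZ : IsSlimGroup G) : IsSlim (CosetCat G) :=
  CosetCat.isSlim_of_isSlimGroup exists_openSubgroup_not_mem hZ

/-- **[FrdII] Thm. 1.2 (iv) UNCONDITIONAL over `𝓑(G)⁰` for a slim profinite `G`**: every `p`-adic Frobenioid (the
tree's `Datum`, `Λ = ℤ`) over the base `CosetCat G` is a slim category — "`D` slim" by `isSlim_cosetCat_of_isSlimGroup`,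
the monoid-data input by FSM-type of `CosetCat G`. [cite: MochizukiFrdII2008, Thm 1.2 (iv) p.9] -/
theorem Datum.isSlim_frobenioid_of_isSlimGroup {p : ℕ} [Fact p.Prime] (hZ : IsSlimGroup G)
    (d : Datum (CosetCat G) p) : IsSlim d.frobenioid :=
  d.thm12_iv_of_isMonoidData (d.isMonoidData_of_isOfFSMType CosetCat.isOfFSMType)
    (isSlim_cosetCat_of_isSlimGroup hZ)

end Profinite

section GalQp

variable (p : ℕ) [Fact p.Prime]

/-- **"over a slim base category `D₀` [cf. [AbsAnab], Theorem 1.1.1, (ii)]"** (FrdII Ex. 1.1 (i) p. 7), UNCONDITIONAL: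
`D₀ = 𝓑(G_{ℚ_p})⁰`, realised as `CosetCat G_{ℚ_p}`, IS a slim category — `G_{ℚ_p}` is slim (abc-iut-L4's
`IsSubpadicFor.isSlimGroup_absoluteGaloisGroup` at `ℚ_p`) and profinite. [cite: MochizukiFrdII2008, Ex 1.1 (i) p.7] -/
theorem isSlim_cosetCat_galQp : IsSlim (CosetCat (QuasiTemperoid.GalFbar ℚ_[p])) := by
  haveI : IsGalois ℚ_[p] (QuasiTemperoid.Fbar ℚ_[p]) := {}
  exact isSlim_cosetCat_of_isSlimGroup
    (IsSubpadicFor.isSlimGroup_absoluteGaloisGroup (AbsTopIII.IsSubpadicFor.padic p))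

/-- **[FrdII] Thm. 1.2 (iv) at THE base `D₀`, UNCONDITIONAL**: every `p`-adic Frobenioid over `D₀ = 𝓑(G_{ℚ_p})⁰`
(in particular Example 1.1 (i)'s `C₀`) is a slim category. [cite: MochizukiFrdII2008, Thm 1.2 (iv) p.9] -/
theorem Datum.isSlim_frobenioid_over_galQp (d : Datum (CosetCat (QuasiTemperoid.GalFbar ℚ_[p])) p) :
    IsSlim d.frobenioid := by
  haveI : IsGalois ℚ_[p] (QuasiTemperoid.Fbar ℚ_[p]) := {}
  exact d.isSlim_frobenioid_of_isSlimGroup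
    (IsSubpadicFor.isSlimGroup_absoluteGaloisGroup (AbsTopIII.IsSubpadicFor.padic p))

end GalQp

end PadicFrd

end Literature.AlgebraicGeometry.Frobenioids
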